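import Literature.Analysis.FluidPDE.WholeSpaceIBP
import HarnessLib

/-!
# Integration by parts against weak gradients; the weak divergence-free condition beyond test functions

Analysis/FluidPDE support file (serves the discharge of the Serrin–Prodi weak–strong uniqueness
theorem `Literature.Analysis.FluidPDE.weak_strong_uniqueness`, sub-fact `Literature.Analysis.FluidPDE.serrin_difference_energy_ineq`:
Serrin 1963, §§3–4).

Let `E`, `F'` be finite-dimensional real inner product spaces, `E` with its Lebesgue measure.

* `HasWeakGradient.integral_inner_fderiv_apply_test`: for `u` with weak gradient `G` on the
  whole space (accepted `Fluid.HasWeakGradient`, i.e. `HasWeakFDerivOn ⊤ volume`) and a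
  vector test field `W ∈ C_c^∞(E; F')`, `∫ ⟪u, ∂ᵥW⟫ = -∫ ⟪G v, W⟫` — the vector form of the
  defining identity (expand `W` in an orthonormal frame of `F'`).
* `HasWeakGradient.integral_inner_laplacian_test`: `∫ ⟪u, ΔΨ⟫ = -Σᵢ ∫ ⟪G eᵢ, ∂ᵢΨ⟫` for
  `Ψ ∈ C_c^∞(E; F')` — the step "`ν⟨u, Δφ⟩ = -ν⟨∇u, ∇φ⟩`" turning the very weak (Leray)
  formulation into the `H¹` one (Serrin 1963, §3; Robinson–Rodrigo–Sadowski 2016, (3.3)–(3.4)).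
* `IsWeaklyDivFree.integral_fderiv_apply_eq_zero`: the weak divergence-free condition
  `∫ ⟪a, ∇θ⟫ = 0`, stated for `θ ∈ C_c^∞`, extends to smooth `θ` with `a·∇θ ∈ L¹` and
  `θ a ∈ L¹` (cut off with the tree's `Fluid.cutoff R`, `|∇χ_R| ≤ C/R`, and let `R → ∞`;
  Serrin 1963, §4, the manipulations of the trilinear term).

## Mathlib search

Mathlib (this pin) has no weak derivatives; the tree has the predicate `HasWeakFDerivOn`
(`SobolevDomain`), the whole-space classical calculus and cut-offs (`WholeSpaceIBP`), and
mollification of weak gradients (`Mollification`), but not these pairings (searched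
`integral_inner_laplacian`, `IsWeaklyDivFree` in `Literature/Analysis/FluidPDE`).

## References

* J. Serrin, *The initial value problem for the Navier–Stokes equations*, in: Nonlinear Problems
  (Madison 1962), Univ. Wisconsin Press 1963, §§3–4.
* J. C. Robinson, J. L. Rodrigo, W. Sadowski, *The three-dimensional Navier–Stokes equations*
  (CUP 2016), Def. 3.3, (3.3)–(3.4).
* L. C. Evans, *Partial Differential Equations*, 2nd ed. (2010), §5.2.1.
-/

noncomputable section

open MeasureTheory TopologicalSpace Set Function Filter Topology InnerProductSpace
open scoped RealInnerProductSpace ENNReal NNReal Laplacian ContDiff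

namespace Literature.Analysis.FluidPDE

variable {E : Type*} [NormedAddCommGroup E] [InnerProductSpace ℝ E] [FiniteDimensional ℝ E]
  [MeasurableSpace E] [BorelSpace E]
variable {F' : Type*} [NormedAddCommGroup F'] [InnerProductSpace ℝ F']

/-! ### Local integrability against compactly supported continuous fields -/

/-- A locally integrable field pairs integrably with a compactly supported continuous field. [folklore] -/
theorem integrable_inner_of_locallyIntegrable_of_hasCompactSupport {μ : Measure E} {u T : E → F'}
    (hu : LocallyIntegrable u μ) (hT : Continuous T) (hTc : HasCompactSupport T) :
    Integrable (fun x => ⟪u x, T x⟫) μ := by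
  obtain ⟨C, hC⟩ := hT.bounded_above_of_compact_support hTc
  have hsupp : support (fun x => ⟪u x, T x⟫) ⊆ tsupport T := fun x hx => by
    by_contra h
    exact hx (by simp [image_eq_zero_of_notMem_tsupport h])
  rw [← integrableOn_iff_integrable_of_support_subset hsupp]
  have hK : IntegrableOn u (tsupport T) μ := hu.integrableOn_isCompact hTc
  refine Integrable.mono' (hK.norm.const_mul C)
    (hK.aestronglyMeasurable.inner hT.aestronglyMeasurable.restrict)
    (Eventually.of_forall fun x => ?_)
  calc ‖⟪u x, T x⟫‖ ≤ ‖u x‖ * ‖T x‖ := norm_inner_le_norm (𝕜 := ℝ) _ _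
    _ ≤ ‖u x‖ * C := by gcongr; exact hC x
    _ = C * ‖u x‖ := mul_comm _ _

/-! ### Vector form of the weak-gradient identity -/

section VectorIBP

variable [FiniteDimensional ℝ F']

omit [MeasurableSpace E] [BorelSpace E] [FiniteDimensional ℝ E] [FiniteDimensional ℝ F'] in
/-- The scalar components `⟪c, W ·⟫` of a vector test field are test functions. [folklore] -/
theorem _root_.Literature.Analysis.FunctionSpaces.IsTestFunctionOn.inner_const_left {W : E → F'}
    (hW : FunctionSpaces.IsTestFunctionOn (⊤ : Opens E) W) (c : F') :
    FunctionSpaces.IsTestFunctionOn (⊤ : Opens E) fun y => ⟪c, W y⟫ where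
  contDiff := contDiff_const.inner ℝ hW.contDiff
  hasCompactSupport := by
    refine hW.hasCompactSupport.mono' fun x hx => subset_tsupport _ ?_
    intro h0
    exact hx (by simp [h0])
  tsupport_subset := by simp

omit [MeasurableSpace E] [BorelSpace E] [FiniteDimensional ℝ E] [FiniteDimensional ℝ F'] in
/-- Derivative of a scalar component: `∂ᵥ ⟪c, W⟫ = ⟪c, ∂ᵥ W⟫`. [folklore] -/
theorem fderiv_inner_const_left_apply {W : E → F'} (hW : Differentiable ℝ W) (c : F') (x v : E) :
    fderiv ℝ (fun y => ⟪c, W y⟫) x v = ⟪c, fderiv ℝ W x v⟫ := by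
  have h1 : HasFDerivAt W (fderiv ℝ W x) x := (hW x).hasFDerivAt
  have h2 := (innerSL ℝ c).hasFDerivAt.comp x h1
  have : (fun y => ⟪c, W y⟫) = (innerSL ℝ c) ∘ W := rfl
  rw [this, h2.fderiv]
  rfl

/-- **Vector form of the weak-gradient identity.** If `G` is a weak gradient of `u : E → F'` on
the whole space and `W ∈ C_c^∞(E; F')`, then `∫ ⟪u, ∂ᵥ W⟫ = -∫ ⟪G v, W⟫` for every direction
`v` (Evans, *PDE*, §5.2.1, Definition, applied to the components `⟪cₖ, W⟫` in an orthonormal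
frame `cₖ` of `F'` and summed with Parseval). [folklore] -/
theorem HasWeakGradient.integral_inner_fderiv_apply_test {u : E → F'} {G : E → E →L[ℝ] F'}
    (hu : HasWeakGradient u G) {W : E → F'} (hW : FunctionSpaces.IsTestFunctionOn (⊤ : Opens E) W) (v : E) :
    ∫ x, ⟪u x, fderiv ℝ W x v⟫ = -∫ x, ⟪G x v, W x⟫ := by
  haveI : CompleteSpace F' := FiniteDimensional.complete ℝ F'
  set c := stdOrthonormalBasis ℝ F' with hc
  have hWd : Differentiable ℝ W := hW.contDiff.differentiable (by simp)
  have hW1 : ContDiff ℝ 1 W := hW.contDiff.of_le (by exact_mod_cast le_top)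
  set φ : Fin (Module.finrank ℝ F') → E → ℝ := fun k y => ⟪c k, W y⟫ with hφ
  have hφtest : ∀ k, FunctionSpaces.IsTestFunctionOn (⊤ : Opens E) (φ k) := fun k => hW.inner_const_left (c k)
  have hφderiv : ∀ k x, fderiv ℝ (φ k) x v = ⟪c k, fderiv ℝ W x v⟫ := fun k x =>
    fderiv_inner_const_left_apply hWd (c k) x v
  have hφ1 : ∀ k, ContDiff ℝ 1 (φ k) := fun k => (hφtest k).contDiff.of_le (by exact_mod_cast le_top)
  -- local integrability of `u` and `G`
  have hul : LocallyIntegrable u volume := locallyIntegrableOn_univ.1 (by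
    simpa only [Opens.coe_top] using hu.locallyIntegrableOn)
  have hGl : LocallyIntegrable G volume := locallyIntegrableOn_univ.1 (by
    simpa only [Opens.coe_top] using hu.locallyIntegrableOn_deriv)
  -- pointwise expansions in the frame `c`
  have hleft : ∀ x, ⟪u x, fderiv ℝ W x v⟫ = ∑ k, fderiv ℝ (φ k) x v * ⟪u x, c k⟫ := by
    intro x
    rw [← c.sum_inner_mul_inner (u x) (fderiv ℝ W x v)]
    exact Finset.sum_congr rfl fun k _ => by rw [hφderiv, mul_comm]
  have hright : ∀ x, ⟪G x v, W x⟫ = ∑ k, φ k x * ⟪G x v, c k⟫ := by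
    intro x
    rw [← c.sum_inner_mul_inner (G x v) (W x)]
    exact Finset.sum_congr rfl fun k _ => by simp only [hφ]; ring
  -- integrability of the summands
  have hj1 : ∀ k, Integrable (fun x => (fderiv ℝ (φ k) x v) • u x) volume := fun k =>
    hul.integrable_smul_left_of_hasCompactSupport
      (((hφ1 k).continuous_fderiv one_ne_zero).clm_apply continuous_const)
      ((hφtest k).hasCompactSupport.fderiv_apply (𝕜 := ℝ) v)
  have hj2 : ∀ k, Integrable (fun x => φ k x • G x v) volume := fun k => by
    have h := hGl.integrable_smul_left_of_hasCompactSupport (hφtest k).contDiff.continuous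
      (hφtest k).hasCompactSupport
    simpa using (ContinuousLinearMap.apply ℝ F' v).integrable_comp h
  have hi1 : ∀ k, Integrable (fun x => fderiv ℝ (φ k) x v * ⟪u x, c k⟫) volume := fun k => by
    have := (hj1 k).inner_const (𝕜 := ℝ) (c k)
    simpa only [real_inner_smul_left] using this
  have hi2 : ∀ k, Integrable (fun x => φ k x * ⟪G x v, c k⟫) volume := fun k => by
    have := (hj2 k).inner_const (𝕜 := ℝ) (c k)
    simpa only [real_inner_smul_left] using this
  simp_rw [hleft, hright]
  rw [integral_finsetSum _ (fun k _ => hi1 k), integral_finsetSum _ (fun k _ => hi2 k),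
    ← Finset.sum_neg_distrib]
  refine Finset.sum_congr rfl fun k _ => ?_
  have e := hu.integral_fderiv_smul_eq (φ k) v (hφtest k)
  simp only [Opens.coe_top, Measure.restrict_univ] at e
  calc ∫ x, fderiv ℝ (φ k) x v * ⟪u x, c k⟫
      = ∫ x, ⟪c k, (fderiv ℝ (φ k) x v) • u x⟫ := by
        congr 1; ext x; rw [real_inner_smul_right, real_inner_comm (c k) (u x)]
    _ = ⟪c k, ∫ x, (fderiv ℝ (φ k) x v) • u x⟫ := integral_inner (hj1 k) (c k)
    _ = -⟪c k, ∫ x, φ k x • G x v⟫ := by rw [e, inner_neg_right]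
    _ = -∫ x, ⟪c k, φ k x • G x v⟫ := by rw [integral_inner (hj2 k)]
    _ = -∫ x, φ k x * ⟪G x v, c k⟫ := by
        congr 1; congr 1; ext x; rw [real_inner_smul_right, real_inner_comm (c k) (G x v)]

omit [MeasurableSpace E] [BorelSpace E] [FiniteDimensional ℝ F'] [FiniteDimensional ℝ E] in
/-- The partial derivatives `∂ᵢΨ` of a test field are test fields. [folklore] -/
theorem _root_.Literature.Analysis.FunctionSpaces.IsTestFunctionOn.fderiv_apply_const {Ψ : E → F'}
    (hΨ : FunctionSpaces.IsTestFunctionOn (⊤ : Opens E) Ψ) (v : E) :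
    FunctionSpaces.IsTestFunctionOn (⊤ : Opens E) fun y => fderiv ℝ Ψ y v where
  contDiff := contDiff_infty.2 fun n =>
    (hΨ.contDiff.fderiv_right (m := n) (by exact_mod_cast le_top)).clm_apply contDiff_const
  hasCompactSupport := hΨ.hasCompactSupport.fderiv_apply (𝕜 := ℝ) v
  tsupport_subset := by simp

/-- **`∫ ⟪u, ΔΨ⟫ = -Σᵢ ∫ ⟪G eᵢ, ∂ᵢΨ⟫`** for `u` with weak gradient `G` on the whole space and a
test field `Ψ ∈ C_c^∞(E; F')` (`eᵢ` the standard orthonormal frame of `E`): the passage from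
the very weak (Leray) form `ν⟨u, Δφ⟩` to the `H¹` form `-ν⟨∇u, ∇φ⟩` of the weak formulation
(Serrin 1963, §3; Robinson–Rodrigo–Sadowski 2016, (3.3)–(3.4)), from
`ΔΨ = Σᵢ ∂ᵢ(∂ᵢΨ)` and the vector weak-gradient identity applied to `W = ∂ᵢΨ`. [folklore] -/
theorem HasWeakGradient.integral_inner_laplacian_test {u : E → F'} {G : E → E →L[ℝ] F'}
    (hu : HasWeakGradient u G) {Ψ : E → F'} (hΨ : FunctionSpaces.IsTestFunctionOn (⊤ : Opens E) Ψ) :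
    ∫ x, ⟪u x, (Δ Ψ) x⟫ =
      -∑ i, ∫ x, ⟪G x (stdOrthonormalBasis ℝ E i),
        fderiv ℝ Ψ x (stdOrthonormalBasis ℝ E i)⟫ := by
  set b := stdOrthonormalBasis ℝ E with hb
  have hΨ2 : ContDiff ℝ 2 Ψ := contDiff_infty.1 hΨ.contDiff 2
  have hW : ∀ i, FunctionSpaces.IsTestFunctionOn (⊤ : Opens E) (fun y => fderiv ℝ Ψ y (b i)) := fun i =>
    hΨ.fderiv_apply_const (b i)
  have hul : LocallyIntegrable u volume := locallyIntegrableOn_univ.1 (by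
    simpa only [Opens.coe_top] using hu.locallyIntegrableOn)
  have hpt : ∀ x, ⟪u x, (Δ Ψ) x⟫ =
      ∑ i, ⟪u x, fderiv ℝ (fun y => fderiv ℝ Ψ y (b i)) x (b i)⟫ := fun x => by
    rw [laplacian_eq_sum_fderiv_fderiv b hΨ2 x, inner_sum]
  have hi : ∀ i, Integrable
      (fun x => ⟪u x, fderiv ℝ (fun y => fderiv ℝ Ψ y (b i)) x (b i)⟫) volume := fun i => by
    have h1 : ContDiff ℝ 1 (fun y => fderiv ℝ Ψ y (b i)) :=
      (hW i).contDiff.of_le (by exact_mod_cast le_top)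
    exact integrable_inner_of_locallyIntegrable_of_hasCompactSupport hul
      ((h1.continuous_fderiv one_ne_zero).clm_apply continuous_const)
      ((hW i).hasCompactSupport.fderiv_apply (𝕜 := ℝ) (b i))
  simp_rw [hpt]
  rw [integral_finsetSum _ (fun i _ => hi i), ← Finset.sum_neg_distrib]
  exact Finset.sum_congr rfl fun i _ => hu.integral_inner_fderiv_apply_test (hW i) (b i)

end VectorIBP

/-! ### The weak divergence-free condition against non-compactly supported smooth functions -/

section DivFree

omit [MeasurableSpace E] [BorelSpace E] [FiniteDimensional ℝ E] in
/-- `⟪a, ∇θ⟫ = Dθ(a)`. [folklore] -/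
theorem inner_gradient_eq_fderiv_apply {θ : E → ℝ} (x a : E) [CompleteSpace E] :
    ⟪a, gradient θ x⟫ = fderiv ℝ θ x a := by
  rw [gradient, real_inner_comm, InnerProductSpace.toDual_symm_apply]

/-- **The weak divergence-free condition beyond test functions.** Let `a` be weakly divergence
free (accepted `Fluid.IsWeaklyDivFree`: `∫ ⟪a, ∇θ⟫ = 0` for `θ ∈ C_c^∞`) and let `θ` be smooth
with `x ↦ Dθ(x)(a x)` and `x ↦ θ(x) a(x)` integrable. Then `∫ Dθ(a) = 0`
(Serrin 1963, §4: the trilinear identities `b(a,c,c) = 0`, `b(a,c,d) = -b(a,d,c)` rest on this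
with `θ = ½|c|²`, `θ = ⟪c,d⟫`). Proof: `θ_R = χ_R θ` with the tree's cut-off `χ_R = cutoff R`
is a test function, so `0 = ∫ Dθ_R(a) = ∫ χ_R Dθ(a) + ∫ θ Dχ_R(a)`; the first integral tends to
`∫ Dθ(a)` (dominated convergence, `χ_R → 1`, `|χ_R| ≤ 1`) and the second is `O(R⁻¹)` since
`|Dχ_R| ≤ C/R` and `θ a ∈ L¹`. [folklore] -/
theorem IsWeaklyDivFree.integral_fderiv_apply_eq_zero {a : E → E} (ha : IsWeaklyDivFree a)
    (hma : AEStronglyMeasurable a volume) {θ : E → ℝ} (hθ : ContDiff ℝ ∞ θ)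
    (h1 : Integrable (fun x => fderiv ℝ θ x (a x)) volume)
    (h2 : Integrable (fun x => θ x • a x) volume) :
    ∫ x, fderiv ℝ θ x (a x) = 0 := by
  haveI : CompleteSpace E := FiniteDimensional.complete ℝ E
  obtain ⟨C, hC0, hC⟩ := exists_norm_fderiv_cutoff_le (E := E)
  have hR : ∀ n : ℕ, (0 : ℝ) < n + 1 := fun n => by positivity
  set χ : ℕ → E → ℝ := fun n => cutoff ((n : ℝ) + 1) with hχ
  have hθd : Differentiable ℝ θ := hθ.differentiable (by simp)
  have hχd : ∀ n, Differentiable ℝ (χ n) := fun n =>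
    (contDiff_cutoff (n := 1) _).differentiable one_ne_zero
  have hχD : ∀ n, Continuous (fderiv ℝ (χ n)) := fun n =>
    (contDiff_cutoff (n := 1) _).continuous_fderiv one_ne_zero
  have hχc : ∀ n, Continuous (χ n) := fun n => (hχd n).continuous
  have hχ1 : ∀ n x, |χ n x| ≤ 1 := fun n x => abs_cutoff_le_one _ _
  have hχtest : ∀ n, FunctionSpaces.IsTestFunctionOn (⊤ : Opens E) (fun x => χ n x * θ x) := fun n =>
    { contDiff := (contDiff_cutoff _).mul hθ
      hasCompactSupport := (hasCompactSupport_cutoff (hR n)).mul_right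
      tsupport_subset := by simp }
  have hzero : ∀ n, ∫ x, ⟪a x, gradient (fun x => χ n x * θ x) x⟫ = 0 := fun n =>
    ha _ (hχtest n)
  have hexp : ∀ n x, ⟪a x, gradient (fun x => χ n x * θ x) x⟫ =
      χ n x * fderiv ℝ θ x (a x) + θ x * fderiv ℝ (χ n) x (a x) := by
    intro n x
    rw [inner_gradient_eq_fderiv_apply, fderiv_fun_mul (hχd n x) (hθd x)]
    simp only [_root_.add_apply, _root_.FunLike.coe_smul, Pi.smul_apply, smul_eq_mul]
  -- integrability of the two parts
  have hi1 : ∀ n, Integrable (fun x => χ n x * fderiv ℝ θ x (a x)) volume := fun n =>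
    h1.bdd_mul (hχc n).aestronglyMeasurable
      (Eventually.of_forall fun x => by simpa [Real.norm_eq_abs] using hχ1 n x)
  have hbound : ∀ n x, ‖θ x * fderiv ℝ (χ n) x (a x)‖ ≤ C / ((n : ℝ) + 1) * ‖θ x • a x‖ := by
    intro n x
    rw [norm_mul, norm_smul]
    calc ‖θ x‖ * ‖fderiv ℝ (χ n) x (a x)‖ ≤ ‖θ x‖ * (C / ((n : ℝ) + 1) * ‖a x‖) := by
          gcongr
          exact (ContinuousLinearMap.le_opNorm _ _).trans (by gcongr; exact hC _ (hR n) x)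
      _ = C / ((n : ℝ) + 1) * (‖θ x‖ * ‖a x‖) := by ring
  have hi2 : ∀ n, Integrable (fun x => θ x * fderiv ℝ (χ n) x (a x)) volume := by
    intro n
    refine (h2.norm.const_mul (C / ((n : ℝ) + 1))).mono' ?_ (Eventually.of_forall (hbound n))
    exact hθ.continuous.aestronglyMeasurable.mul
      (isBoundedBilinearMap_apply.continuous.comp_aestronglyMeasurable
        ((hχD n).aestronglyMeasurable.prodMk hma))
  -- the identity `∫ χₙ Dθ(a) = -∫ θ Dχₙ(a)`
  have hid : ∀ n, ∫ x, χ n x * fderiv ℝ θ x (a x) = -∫ x, θ x * fderiv ℝ (χ n) x (a x) := by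
    intro n
    have h0 := hzero n
    simp_rw [hexp n] at h0
    rw [integral_add (hi1 n) (hi2 n)] at h0
    linarith
  -- limits
  have hlim1 : Tendsto (fun n => ∫ x, χ n x * fderiv ℝ θ x (a x)) atTop
      (𝓝 (∫ x, fderiv ℝ θ x (a x))) := by
    have := tendsto_integral_of_dominated_convergence (fun x => ‖fderiv ℝ θ x (a x)‖)
      (fun n => (hi1 n).aestronglyMeasurable) h1.norm
      (fun n => Eventually.of_forall fun x => by
        rw [norm_mul]
        calc ‖χ n x‖ * ‖fderiv ℝ θ x (a x)‖ ≤ 1 * ‖fderiv ℝ θ x (a x)‖ := by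
              gcongr; simpa [Real.norm_eq_abs] using hχ1 n x
          _ = _ := one_mul _)
      (Eventually.of_forall fun x => by
        simpa using (tendsto_cutoff_natCast_add_one x).mul_const (fderiv ℝ θ x (a x)))
    simpa using this
  have hlim2 : Tendsto (fun n => ∫ x, θ x * fderiv ℝ (χ n) x (a x)) atTop (𝓝 0) := by
    have hb : ∀ n, ‖∫ x, θ x * fderiv ℝ (χ n) x (a x)‖ ≤
        C / ((n : ℝ) + 1) * ∫ x, ‖θ x • a x‖ := fun n => by
      calc ‖∫ x, θ x * fderiv ℝ (χ n) x (a x)‖ ≤ ∫ x, ‖θ x * fderiv ℝ (χ n) x (a x)‖ :=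
            norm_integral_le_integral_norm _
        _ ≤ ∫ x, C / ((n : ℝ) + 1) * ‖θ x • a x‖ :=
            integral_mono_of_nonneg (Eventually.of_forall fun x => norm_nonneg _)
              (h2.norm.const_mul _) (Eventually.of_forall (hbound n))
        _ = C / ((n : ℝ) + 1) * ∫ x, ‖θ x • a x‖ := integral_const_mul _ _
    have h0 : Tendsto (fun n : ℕ => C / ((n : ℝ) + 1) * ∫ x, ‖θ x • a x‖) atTop (𝓝 0) := by
      have := (tendsto_one_div_add_atTop_nhds_zero_nat.const_mul C).mul_const
        (∫ x, ‖θ x • a x‖)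
      rw [mul_zero, zero_mul] at this
      exact this.congr fun n => by ring
    exact squeeze_zero_norm hb h0
  have hlim3 : Tendsto (fun n => ∫ x, χ n x * fderiv ℝ θ x (a x)) atTop (𝓝 0) := by
    simp_rw [hid]
    simpa using hlim2.neg
  exact tendsto_nhds_unique hlim1 hlim3

/-- Inner-product form of `IsWeaklyDivFree.integral_fderiv_apply_eq_zero`: `∫ ⟪a, ∇θ⟫ = 0` for
smooth `θ` with `a·∇θ, θ a ∈ L¹` (Serrin 1963, §4). [folklore] -/
theorem IsWeaklyDivFree.integral_inner_gradient_eq_zero {a : E → E} (ha : IsWeaklyDivFree a)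
    (hma : AEStronglyMeasurable a volume) {θ : E → ℝ} (hθ : ContDiff ℝ ∞ θ)
    (h1 : Integrable (fun x => fderiv ℝ θ x (a x)) volume)
    (h2 : Integrable (fun x => θ x • a x) volume) :
    ∫ x, ⟪a x, gradient θ x⟫ = 0 := by
  haveI : CompleteSpace E := FiniteDimensional.complete ℝ E
  simp_rw [inner_gradient_eq_fderiv_apply]
  exact ha.integral_fderiv_apply_eq_zero hma hθ h1 h2

end DivFree

end Literature.Analysis.FluidPDE
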